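import Literature.NumberTheory.Automorphic.RSLFactorGLOneMeasureIndependence
import Literature.NumberTheory.Automorphic.WhittakerSphericalNonvanishing
import HarnessLib

/-!
# The unramified `L`-factor divides every JPSS `L`-polynomial of `(π, 1)` on `GL₂`:
# `∏_{a ∈ α} (1 - a T) ∣ P` for a Satake parameter `α` of `π`

Topic `Literature/NumberTheory/Automorphic`; proof file (theorems only: no definition, no named
fact, no instance).  Let `F` be a non-archimedean local field (`q = #k_F`), `π` an IRREDUCIBLE
smooth representation of `GL₂(F)` on `V`, generic for the continuous non-trivial additive character
`ψ`, and `α` a Satake parameter of `π` (`IsSatakeParameter π ϖ α` of `SatakeParametersGL`: a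
non-zero `GL₂(𝒪)`-fixed vector `v₀` with `T₁ v₀ = q^{1/2} e₁(α) v₀`, `T₂ v₀ = e₂(α) v₀`).  Then
(`exists_measure_forall_hasRSLFactor_dvd`) for the invariant measure `ν` on `GL₁(F) ⧸ U₁ = Fˣ`
(a transported Haar measure) every polynomial `P` with `HasRSLFactor (1<2) π 𝟙_{GL₁} ψ ν P` — a
JPSS `L`-polynomial of the pair `(π, 1)`, `L(s, π × 1) = 1 / P(q^{-s})` (`RankinSelbergLocal`) — is
divisible by the unramified polynomial `P_α = ∏_{a ∈ α} (1 - a X)`, and equals it if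
`deg P ≤ 2` (`eq_of_hasRSLFactor_of_natDegree_le_two`).  In words: the standard `L`-factor of a
representation carrying the Hecke eigenvalues of `α` has at least the poles of
`∏ (1 - a q^{-s})⁻¹` (Jacquet–Langlands 1970, Prop. 3.5: `L(s, π(μ₁, μ₂)) = L(s, μ₁) L(s, μ₂)`;
Jacquet–Piatetski-Shapiro–Shalika 1983, Thm. 2.7 (ii); the unramified computation of
Jacquet–Shalika 1981, §2 / Cogdell 2004, Thm. 3.3, read for the single spherical test vector).
No classification of the spherical representations of `GL₂(F)` is used.

## Proof

1.  `comp_mem_whittakerFunctionals_mulShift`: for `a ∈ Fˣ` and a `ψ`-Whittaker functional `Λ`,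
    `Λ_a = Λ ∘ π(d(a,1))` is a `ψ_a`-Whittaker functional, `ψ_a = ψ(a ·)`; choose `a` with `ψ_a`
    of conductor `𝒪` (`AddChar.IsContinuousNontrivial.exists_mulShift_hasConductorExp_zero`).
2.  The torus function `Φ(h) = W_{v₁}(d(h,1))` of `v₁ = π(d(a,1)) v₀` for `Λ` is the torus function
    of `v₀` for `Λ_a` (the torus is commutative).  By Shintani's recursion for the unramified
    Whittaker–Hecke datum `W_{v₀}` (`isUnramifiedWhittakerDatum_whittakerModel`, `normTorus_pieri`
    of `ShintaniWhittakerFormula` at `r = 1, 2` and the weights `(k, 0)`), the central action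
    `π(ϖ · 1) v₀ = e₂ v₀` (`T₂`, `heckeT_self_apply`) and the vanishing off the antitone cone
    (`apply_piPowGL_eq_zero_of_not_antitone`): `Φ` is supported in `𝒪 ∖ 0` and satisfies
    `Φ(h ϖ²) - q^{-1/2} e₁ Φ(h ϖ) + q^{-1} e₂ Φ(h) = 0` for `|h| ≤ q` (`torus_recursion`), while
    `Φ(1) = Λ_a(v₀) ≠ 0` (`whittakerModel_apply_one_ne_zero_of_spherical`, Casselman–Shalika).
3.  The torus zeta integral (`rsZeta_eq_integral_torus` of `WhittakerTorusJacquetGL2`) therefore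
    satisfies `P_α(q^{-s}) Ψ(s; W_{v₁}, 1) = Φ(1) μ'(𝒪ˣ)` EXACTLY for `re s ≫ 0`
    (`mul_integral_torus_eq_const`: substituting `h ↦ h ϖⁱ` in the recursion leaves the single shell
    `|h| = q²`, as in `exists_sum_mul_integral_eq_sum` there).
4.  Clause (a) of `HasRSLFactor` for the pair `(W_{v₁}, 1)` gives `Ψ = R(q^{-s}) / P(q^{-s})` with
    `R` Laurent; comparing at `s = j ∈ ℕ` large: `P_α R = c X^e P` in `ℂ[X]` with `c ≠ 0`, so
    `P_α ∣ P` (`P_α(0) = 1` is prime to `X`).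

## References

* H. Jacquet, R. P. Langlands, *Automorphic forms on GL(2)*, LNM 114 (1970), Prop. 3.5, Thm. 2.18.
  [JacquetLanglands1970]
* H. Jacquet, I. I. Piatetski-Shapiro, J. Shalika, *Rankin–Selberg convolutions*, Amer. J. Math.
  105 (1983), Thm. 2.7 (ii). [JacquetPiatetskiShapiroShalika1983]
* H. Jacquet, J. A. Shalika, Amer. J. Math. 103 (1981), §2, Prop. (2.3). [JacquetShalika1981]
* J. W. Cogdell, *Analytic theory of L-functions for GL_n* (2004), Thm. 3.3. [CogdellAnalyticTheory2004]
* T. Shintani, Proc. Japan Acad. 52 (1976), 180–182. [Shintani1976]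
* W. Casselman, J. Shalika, Compositio Math. 41 (1980), Thm. 5.4. [CasselmanShalika1980]
-/

noncomputable section

open scoped MatrixGroups NNReal ENNReal
open MeasureTheory ValuativeRel Polynomial Filter Finset
  Literature.NumberTheory.GaloisRepresentations.IsNonarchimedeanLocalField
  Literature.NumberTheory.EllipticCurves.Hida2000Thm326
  Literature.RingTheory.SymmetricFunctions.SymmPoly

namespace Literature.NumberTheory.Automorphic

/-! ### Part 1: torus bookkeeping on `GL₂` -/

section Algebra

variable {F : Type*} [Field F]

/-- `diagonalGL (Fin 2) F ![a, b] = d(a, b)`. [folklore] -/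
theorem diagonalGL_fin_two (a b : Fˣ) : diagonalGL (Fin 2) F ![a, b] = diagGL2 a b := by
  refine Units.ext ?_
  rw [coe_diagonalGL, coe_diagGL2]
  ext i j
  fin_cases i <;> fin_cases j <;> simp

/-- `ϖ^{(k, l)} = d(ϖ^k, ϖ^l)` for integral exponents. [folklore] -/
theorem zpowDiagGL_fin_two {ϖ : F} (hϖ : ϖ ≠ 0) (k l : ℤ) :
    zpowDiagGL hϖ ![k, l] = diagGL2 (Units.mk0 ϖ hϖ ^ k) (Units.mk0 ϖ hϖ ^ l) := by
  rw [zpowDiagGL, ← diagonalGL_fin_two]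
  congr 1
  funext i
  fin_cases i <;> rfl

/-- `ϖ^{(k, l)} = d(ϖ^k, ϖ^l)` for natural exponents. [folklore] -/
theorem piPowGL_fin_two {ϖ : F} (hϖ : ϖ ≠ 0) (k l : ℕ) :
    piPowGL hϖ ![k, l] = diagGL2 (Units.mk0 ϖ hϖ ^ k) (Units.mk0 ϖ hϖ ^ l) := by
  rw [piPowGL_eq_diagonalGL, ← diagonalGL_fin_two]
  congr 1
  funext i
  fin_cases i <;> rfl

/-- `b((k, l)) = k - l` for the torus exponent `b(μ) = ∑ μ_i (n - 1 - 2i)` on `GL₂`. [folklore] -/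
theorem torusExponent_fin_two (k l : ℕ) : torusExponent ![k, l] = (k : ℤ) - l := by
  rw [torusExponent, Fin.sum_univ_two]
  simp
  ring

/-- `(k, l)` is antitone iff `l ≤ k`. [folklore] -/
theorem antitone_vec_fin_two_iff {k l : ℕ} : Antitone (![k, l] : Fin 2 → ℕ) ↔ l ≤ k := by
  constructor
  · intro h
    have := h (show (0 : Fin 2) ≤ 1 by decide)
    simpa using this
  · intro h i j hij
    fin_cases i <;> fin_cases j <;> simp at hij ⊢
    exact h

/-- `(k, l) + 1_{{0}} = (k + 1, l)`. [folklore] -/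
theorem addOn_singleton_zero_fin_two (k l : ℕ) : addOn {0} ![k, l] = ![k + 1, l] := by
  funext i
  fin_cases i <;> simp [addOn_apply]

/-- `(k, l) + 1_{{1}} = (k, l + 1)`. [folklore] -/
theorem addOn_singleton_one_fin_two (k l : ℕ) : addOn {1} ![k, l] = ![k, l + 1] := by
  funext i
  fin_cases i <;> simp [addOn_apply]

/-- `(k, l) + 1_{{0,1}} = (k + 1, l + 1)`. [folklore] -/
theorem addOn_univ_fin_two (k l : ℕ) : addOn univ ![k, l] = ![k + 1, l + 1] := by
  funext i
  fin_cases i <;> simp [addOn_apply]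

/-- The `1`-element subsets of `{0, 1}`. [folklore] -/
theorem powersetCard_one_univ_fin_two :
    powersetCard 1 (univ : Finset (Fin 2)) = {{0}, {1}} := by
  decide

/-- The `2`-element subsets of `{0, 1}`. [folklore] -/
theorem powersetCard_two_univ_fin_two :
    powersetCard 2 (univ : Finset (Fin 2)) = {univ} := by
  decide

/-- `e₁(x₀, x₁) = x₀ + x₁`. [folklore] -/
theorem esymm_fin_two_one {R : Type*} [CommRing R] (x : Fin 2 → R) : esymm x 1 = x 0 + x 1 := by
  rw [esymm, powersetCard_one_univ_fin_two, Finset.sum_pair (by decide)]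
  simp

/-- `e₂(x₀, x₁) = x₀ x₁`. [folklore] -/
theorem esymm_fin_two_two {R : Type*} [CommRing R] (x : Fin 2 → R) : esymm x 2 = x 0 * x 1 := by
  rw [esymm, powersetCard_two_univ_fin_two, Finset.sum_singleton, Fin.prod_univ_two]

/-- `∏_{a ∈ {x₀, x₁}} (1 - a X) = 1 - e₁ X + e₂ X²`. [folklore] -/
theorem prod_one_sub_C_mul_X_fin_two (x : Fin 2 → ℂ) :
    (((univ : Finset (Fin 2)).val.map x).map fun a => (1 : ℂ[X]) - C a * X).prod =
      1 - C (esymm x 1) * X + C (esymm x 2) * X ^ 2 := by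
  rw [Multiset.map_map, Finset.prod_map_val, Fin.prod_univ_two, esymm_fin_two_one, esymm_fin_two_two]
  simp only [Function.comp_apply, map_add, map_mul]
  ring

end Algebra

/-! ### Part 2: shifting the additive character of a Whittaker functional -/

section Shift

variable {F : Type*} [Field F] {V : Type*} [AddCommGroup V] [Module ℂ V]
  (π : Representation ℂ (GL (Fin 2) F) V)

/-- **`Λ ∘ π(d(a, 1))` is a `ψ(a ·)`-Whittaker functional** for a `ψ`-Whittaker functional `Λ`:
`d(a,1) n(x) d(a,1)⁻¹ = n(a x)`. (Cogdell 2004, §3.1: translating the test vector changes the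
additive character.) [cite: CogdellAnalyticTheory2004, §3.1] -/
theorem comp_mem_whittakerFunctionals_mulShift {ψ : AddChar F Circle} {Λ : Module.Dual ℂ V}
    (hΛ : Λ ∈ whittakerFunctionals π ψ) (a : Fˣ) :
    Λ ∘ₗ (π (diagGL2 a 1) : V →ₗ[ℂ] V) ∈ whittakerFunctionals π (ψ.mulShift a) := by
  rw [mem_whittakerFunctionals_iff]
  intro u v
  have hd : ∀ i j : Fin 2, (i : ℕ) + 1 = j → ((![a, 1] : Fin 2 → Fˣ) i : F) *
      (((![a, 1] : Fin 2 → Fˣ) j)⁻¹ : Fˣ) = a := by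
    intro i j hij
    fin_cases i <;> fin_cases j <;> simp at hij ⊢
  have hconj := whittakerCharFun_diagonalGL_conj ψ ![a, 1] a hd u
  set d : GL (Fin 2) F := diagonalGL (Fin 2) F ![a, 1] with hd_def
  have hdg : d = diagGL2 a 1 := diagonalGL_fin_two a 1
  rw [LinearMap.comp_apply, LinearMap.comp_apply, ← hconj, ← hdg]
  have key := (mem_whittakerFunctionals_iff Λ).1 hΛ
    ⟨d * (u : GL (Fin 2) F) * d⁻¹, diagonalGL_conj_mem_upperUnitriangular _ u.2⟩ (π d v)
  rw [← key]
  change Λ (π d (π (u : GL (Fin 2) F) v)) = Λ (π (d * (u : GL (Fin 2) F) * d⁻¹) (π d v))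
  rw [← Module.End.mul_apply, ← map_mul, ← Module.End.mul_apply, ← map_mul, inv_mul_cancel_right]

/-- `Λ ∘ π(g) ≠ 0` for `Λ ≠ 0`. [folklore] -/
theorem comp_ne_zero_of_ne_zero {Λ : Module.Dual ℂ V} (hΛ : Λ ≠ 0) (g : GL (Fin 2) F) :
    Λ ∘ₗ (π g : V →ₗ[ℂ] V) ≠ 0 := by
  intro h
  apply hΛ
  ext v
  have := LinearMap.congr_fun h (π g⁻¹ v)
  rw [LinearMap.comp_apply, ← Module.End.mul_apply, ← map_mul, mul_inv_cancel, map_one,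
    Module.End.one_apply] at this
  rw [this, LinearMap.zero_apply, LinearMap.zero_apply]

/-- The torus function of `π(d(a,1)) v` for `Λ` is the torus function of `v` for `Λ ∘ π(d(a,1))`
(the diagonal torus is commutative). [folklore] -/
theorem whittakerModel_apply_diagGL2_diagGL2_eq_comp (Λ : Module.Dual ℂ V) (v : V) (a h : Fˣ) :
    whittakerModel π Λ (π (diagGL2 a 1) v) (diagGL2 h 1) =
      whittakerModel π (Λ ∘ₗ (π (diagGL2 a 1) : V →ₗ[ℂ] V)) v (diagGL2 h 1) := by
  rw [whittakerModel_apply, whittakerModel_apply, LinearMap.comp_apply, ← Module.End.mul_apply,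
    ← map_mul, ← Module.End.mul_apply, ← map_mul, ← diagGL2_mul, ← diagGL2_mul, mul_comm a h]

end Shift

/-! ### Part 3: the torus function of a spherical Hecke eigenvector (character of conductor `𝒪`) -/

section Spherical

variable {F : Type*} [Field F] [ValuativeRel F] [TopologicalSpace F] [IsNonarchimedeanLocalField F]

/-- **`|ϖ|_F = q⁻¹` for a uniformizing element `ϖ`** (it has absolute value `< 1`, hence `≤ q⁻¹`,
and divides any element of absolute value `q⁻¹` in `𝒪`). [folklore] -/
theorem normAbs_eq_inv_of_isUniformizingElement {ϖ : F} (h : IsUniformizingElement ϖ) :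
    normAbs F ϖ = (residueFieldCard F : ℝ≥0)⁻¹ := by
  refine le_antisymm (normAbs_le_inv_of_lt_one (normAbs_lt_one_iff.2 h.valuation_lt_one)) ?_
  obtain ⟨a, ha0, ha⟩ := exists_normAbs_eq_inv (F := F)
  have ha1 : normAbs F a < 1 := by rw [ha]; exact inv_residueFieldCard_lt_one
  obtain ⟨y, hy, hay⟩ := h.exists_eq_mul (normAbs_le_one_iff.1 ha1.le) (normAbs_lt_one_iff.1 ha1)
  calc (residueFieldCard F : ℝ≥0)⁻¹ = normAbs F a := ha.symm
    _ = normAbs F ϖ * normAbs F y := by rw [hay, map_mul]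
    _ ≤ normAbs F ϖ * 1 := mul_le_mul_right (normAbs_le_one_iff.2 hy) _
    _ = normAbs F ϖ := mul_one _

omit [ValuativeRel F] [TopologicalSpace F] [IsNonarchimedeanLocalField F] in
/-- `heckeDiag 2 ϖ 2 = d(ϖ, ϖ) = ϖ · 1`. [folklore] -/
theorem heckeDiag_two_two (ϖ : Fˣ) : heckeDiag 2 ϖ 2 = diagGL2 ϖ ϖ := by
  refine Units.ext ?_
  rw [coe_heckeDiag, coe_diagGL2]
  ext i j
  fin_cases i <;> fin_cases j <;> simp

variable {V : Type*} [AddCommGroup V] [Module ℂ V] (π : Representation ℂ (GL (Fin 2) F) V)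
  {ϖ : F} (hϖ : IsUniformizingElement ϖ) {ψ : AddChar F Circle} (hψ : ψ.HasConductorExp 0)
  {Λ : Module.Dual ℂ V} (hΛ : Λ ∈ whittakerFunctionals π ψ) {v : V}
  (hv : v ∈ π.fixedPoints (glInt 2 F)) (hv0 : v ≠ 0) {x : Fin 2 → ℂ}
  (hT : ∀ r, 1 ≤ r → r ≤ 2 → heckeT π (Units.mk0 ϖ hϖ.ne_zero) r v =
    ((((Real.sqrt (residueFieldCard F)) ^ (r * (2 - r)) : ℝ) : ℂ) * esymm x r) • v)

include hT in
/-- The Hecke eigen-equations in the form of `IsUnramifiedWhittakerDatum`. [folklore] -/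
theorem heckeT_eq_smul_of_eigen (r : ℕ) (hr1 : 1 ≤ r) (hr2 : r ≤ 2) :
    heckeT π (Units.mk0 ϖ hϖ.ne_zero) r v =
      (((Real.sqrt (residueFieldCard F) : ℝ) : ℂ) ^ (r * (2 - r)) * esymm x r) • v := by
  rw [hT r hr1 hr2]; push_cast; rfl

include hv hT in
/-- **The centre acts on the spherical Hecke eigenvector through `T₂`**: `π(ϖ · 1) v = e₂(x) v`
(`T₂ = π(ϖ · 1)` on `V^{GL₂(𝒪)}`, `heckeT_self_apply`). [folklore] -/
theorem apply_diagGL2_self_eq_smul :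
    π (diagGL2 (Units.mk0 ϖ hϖ.ne_zero) (Units.mk0 ϖ hϖ.ne_zero)) v = esymm x 2 • v := by
  have h2 := heckeT_eq_smul_of_eigen π hϖ hT 2 (by norm_num) le_rfl
  rw [heckeT_self_apply π _ hv, heckeDiag_two_two] at h2
  rw [h2, Nat.sub_self, mul_zero, pow_zero, one_mul]

include hv hv0 hT in
/-- `e₂(x) ≠ 0` (it is the eigenvalue of the invertible `π(ϖ · 1)` on `v ≠ 0`). [folklore] -/
theorem esymm_two_ne_zero_of_eigen : esymm x 2 ≠ 0 := by
  have h2 : heckeT π (Units.mk0 ϖ hϖ.ne_zero) 2 v = esymm x 2 • v := by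
    rw [heckeT_eq_smul_of_eigen π hϖ hT 2 (by norm_num) le_rfl, Nat.sub_self, mul_zero, pow_zero,
      one_mul]
  exact (apply_heckeDiag_self_inv_pow_of_eigen π _ hv hv0 h2 0).1

include hψ hΛ hv hv0 hT in
/-- **Negative torus exponents**: `W_v(d(ϖ^{-N}, 1)) = 0` for `N ≥ 1`
(`d(ϖ^{-N}, 1) = ϖ^{(0, N)} (ϖ · 1)^{-N}`, the centre acts by `e₂^{-N}`, and `(0, N)` is not
antitone). [cite: Shintani1976, Theorem (p. 181)] -/
theorem whittakerModel_diagGL2_zpow_neg_eq_zero {N : ℕ} (hN : 0 < N) :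
    whittakerModel π Λ v (diagGL2 (Units.mk0 ϖ hϖ.ne_zero ^ (-(N : ℤ))) 1) = 0 := by
  have hd := isUnramifiedWhittakerDatum_whittakerModel π hϖ hΛ hv (heckeT_eq_smul_of_eigen π hϖ hT)
  have h2 : heckeT π (Units.mk0 ϖ hϖ.ne_zero) 2 v = esymm x 2 • v := by
    rw [heckeT_eq_smul_of_eigen π hϖ hT 2 (by norm_num) le_rfl, Nat.sub_self, mul_zero, pow_zero,
      one_mul]
  obtain ⟨-, hpow⟩ := apply_heckeDiag_self_inv_pow_of_eigen π _ hv hv0 h2 N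
  -- `d(ϖ^{-N}, 1) = ϖ^{(0,N)} · (ϖ · 1)^{-N}`
  have hsplit : (![-(N : ℤ), 0] : Fin 2 → ℤ) =
      (fun i => (((![0, N] : Fin 2 → ℕ) i : ℕ) : ℤ)) + fun _ => -(N : ℤ) := by
    funext i; fin_cases i <;> simp
  have hfac : diagGL2 (Units.mk0 ϖ hϖ.ne_zero ^ (-(N : ℤ))) 1 =
      piPowGL hϖ.ne_zero ![0, N] * (heckeDiag 2 (Units.mk0 ϖ hϖ.ne_zero) 2)⁻¹ ^ N := by
    have h := zpowDiagGL_fin_two hϖ.ne_zero (-(N : ℤ)) 0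
    rw [zpow_zero] at h
    rw [← h, hsplit, zpowDiagGL_add, zpowDiagGL_natCast, zpowDiagGL_const_neg_natCast]
  have hna : ¬ Antitone (![0, N] : Fin 2 → ℕ) := by rw [antitone_vec_fin_two_iff]; omega
  rw [hfac, whittakerModel_apply_apply_mul, hpow, map_smul, Pi.smul_apply, smul_eq_mul,
    apply_piPowGL_eq_zero_of_not_antitone hϖ (hψ.exists_apply_inv_mul_ne_one hϖ) hd.equivariant
      hd.spherical hna, mul_zero]

include hψ hΛ hv hv0 hT in
/-- **The torus recursion of the spherical Whittaker function** (Shintani's dual Pieri recursion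
for `r = 1, 2` at the weights `(m, 0)`): with `s = q^{1/2}` and `W_k = W_v(d(ϖ^k, 1))`,
`s² W_{m+1} - s e₁(x) W_m + e₂(x) W_{m-1} = 0` for every `m ∈ ℕ` (`W_{-1} = 0`).
[cite: Shintani1976, Theorem (p. 181)] -/
theorem whittakerModel_diagGL2_recursion (m : ℕ) :
    (((Real.sqrt (residueFieldCard F) : ℝ) : ℂ)) ^ 2 *
        whittakerModel π Λ v (diagGL2 (Units.mk0 ϖ hϖ.ne_zero ^ ((m : ℤ) + 1)) 1) -
      ((Real.sqrt (residueFieldCard F) : ℝ) : ℂ) * esymm x 1 *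
        whittakerModel π Λ v (diagGL2 (Units.mk0 ϖ hϖ.ne_zero ^ (m : ℤ)) 1) +
      esymm x 2 * whittakerModel π Λ v (diagGL2 (Units.mk0 ϖ hϖ.ne_zero ^ ((m : ℤ) - 1)) 1) = 0 := by
  set s : ℂ := ((Real.sqrt (residueFieldCard F) : ℝ) : ℂ) with hs_def
  have hs : s ≠ 0 := sqrt_residueFieldCard_ne_zero
  have hq : ((Nat.card 𝓀[F] : ℕ) : ℂ) = s ^ 2 := sqrt_residueFieldCard_sq.symm
  have hd := isUnramifiedWhittakerDatum_whittakerModel π hϖ hΛ hv (heckeT_eq_smul_of_eigen π hϖ hT)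
  have hψ1 : ∀ c ∈ 𝒪[F], ψ c = 1 := fun c hc => hψ.eq_one_of_mem hc
  set W : GL (Fin 2) F → ℂ := whittakerModel π Λ v with hW_def
  -- the normalised torus values at `(k, 0)` and `(k, 1)`
  have hnT0 : ∀ k : ℕ, normTorus hϖ W s ![k, 0] =
      s ^ (k : ℤ) * W (diagGL2 (Units.mk0 ϖ hϖ.ne_zero ^ (k : ℤ)) 1) := by
    intro k
    rw [normTorus, torusExponent_fin_two, piPowGL_fin_two, pow_zero, Nat.cast_zero, sub_zero,
      ← zpow_natCast (Units.mk0 ϖ hϖ.ne_zero) k]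
  -- Pieri at `r = 1` and `r = 2`
  have P1 : ∀ k : ℕ, esymm x 1 * normTorus hϖ W s ![k, 0] =
      normTorus hϖ W s ![k + 1, 0] + normTorus hϖ W s ![k, 1] := by
    intro k
    have h := normTorus_pieri hψ1 hd hs hq (antitone_vec_fin_two_iff.2 (Nat.zero_le k)) le_rfl one_le_two
    rwa [powersetCard_one_univ_fin_two, Finset.sum_pair (by decide), addOn_singleton_zero_fin_two,
      addOn_singleton_one_fin_two] at h
  have P2 : ∀ k : ℕ, esymm x 2 * normTorus hϖ W s ![k, 0] = normTorus hϖ W s ![k + 1, 1] := by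
    intro k
    have h := normTorus_pieri hψ1 hd hs hq (antitone_vec_fin_two_iff.2 (Nat.zero_le k)) one_le_two le_rfl
    rwa [powersetCard_two_univ_fin_two, Finset.sum_singleton, addOn_univ_fin_two] at h
  have N01 : normTorus hϖ W s ![0, 1] = 0 :=
    normTorus_eq_zero_of_not_antitone (hψ.exists_apply_inv_mul_ne_one hϖ) hd
      (by rw [antitone_vec_fin_two_iff]; omega)
  rcases m with _ | m
  · -- `m = 0`: `e₁ W_0 = s W_1` and `W_{-1} = 0`
    have h : esymm x 1 * W (diagGL2 1 1) = s * W (diagGL2 (Units.mk0 ϖ hϖ.ne_zero) 1) := by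
      have h := P1 0
      rw [N01, add_zero, hnT0, hnT0] at h
      simpa only [Nat.cast_zero, zero_add, Nat.cast_one, zpow_zero, zpow_one, one_mul] using h
    have hneg : W (diagGL2 (Units.mk0 ϖ hϖ.ne_zero ^ (-1 : ℤ)) 1) = 0 := by
      have h' := whittakerModel_diagGL2_zpow_neg_eq_zero π hϖ hψ hΛ hv hv0 hT Nat.one_pos
      simpa only [Nat.cast_one] using h'
    have e1 : ((0 : ℕ) : ℤ) + 1 = 1 := by norm_num
    have e2 : ((0 : ℕ) : ℤ) - 1 = -1 := by norm_num
    rw [e1, e2, Nat.cast_zero, zpow_zero, zpow_one, hneg, mul_zero, add_zero]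
    linear_combination -s * h
  · -- `m + 1 ≥ 1`
    have h1 := P1 (m + 1)
    have h2 := P2 m
    rw [← h2, hnT0, hnT0, hnT0] at h1
    have e1 : ((m + 1 : ℕ) : ℤ) + 1 = ((m + 1 + 1 : ℕ) : ℤ) := by push_cast; ring
    have e2 : ((m + 1 : ℕ) : ℤ) - 1 = ((m : ℕ) : ℤ) := by push_cast; ring
    rw [e1, e2]
    -- `h1 : e₁ s^{m+1} W_{m+1} = s^{m+2} W_{m+2} + s^{m} e₂ (s^m)⁻¹ ...`; clear the powers of `s`
    have hpow1 : s ^ (((m + 1 + 1 : ℕ)) : ℤ) = s ^ ((m : ℕ) : ℤ) * s ^ 2 := by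
      rw [← zpow_natCast s 2, ← zpow_add₀ hs]; congr 1
    have hpow2 : s ^ (((m + 1 : ℕ)) : ℤ) = s ^ ((m : ℕ) : ℤ) * s := by
      rw [← zpow_add_one₀ hs]; congr 1
    rw [hpow1, hpow2] at h1
    have hsm : s ^ ((m : ℕ) : ℤ) ≠ 0 := zpow_ne_zero _ hs
    apply mul_left_cancel₀ hsm
    linear_combination -h1

include hΛ hv hT in
/-- **Sphericity on the torus**: `W_v(d(h u, 1)) = W_v(d(h, 1))` for `|u| = 1`. [folklore] -/
theorem whittakerModel_diagGL2_mul_unit (h : Fˣ) {u : Fˣ} (hu : valuation F (u : F) = 1) :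
    whittakerModel π Λ v (diagGL2 (h * u) 1) = whittakerModel π Λ v (diagGL2 h 1) := by
  have hd := isUnramifiedWhittakerDatum_whittakerModel π hϖ hΛ hv (heckeT_eq_smul_of_eigen π hϖ hT)
  have hmul : diagGL2 (h * u) 1 = diagGL2 h 1 * diagGL2 u 1 := by rw [← diagGL2_mul, mul_one]
  have hK : diagGL2 u 1 ∈ glInt 2 F := by
    rw [← diagonalGL_fin_two]
    refine diagonalGL_mem_glInt fun i => ?_
    fin_cases i
    · exact hu
    · simp
  rw [hmul, hd.spherical _ hK]

include hΛ hv hT in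
/-- The spherical torus function is constant on the unit sphere. [folklore] -/
theorem whittakerModel_diagGL2_eq_of_normAbs_eq_one (a : Fˣ) (ha : normAbs F (a : F) = 1) :
    whittakerModel π Λ v (diagGL2 a 1) = whittakerModel π Λ v (diagGL2 1 1) := by
  rw [← one_mul a]
  exact whittakerModel_diagGL2_mul_unit π hϖ hΛ hv hT 1 (normAbs_eq_one_iff_valuation_eq_one.1 ha)

/-- `a = ϖ^k u` with `|u| = 1` and `|a| = q^{-k}`, as units. [folklore] -/
theorem exists_eq_zpow_mul_unit (a : Fˣ) :
    ∃ (k : ℤ) (u : Fˣ), valuation F (u : F) = 1 ∧ a = Units.mk0 ϖ hϖ.ne_zero ^ k * u ∧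
      normAbs F (a : F) = (residueFieldCard F : ℝ≥0)⁻¹ ^ k := by
  obtain ⟨k, e, he, hake⟩ := exists_eq_zpow_mul_of_ne_zero hϖ a.ne_zero
  have he0 : e ≠ 0 := fun h => by rw [h, map_zero] at he; exact zero_ne_one he
  refine ⟨k, Units.mk0 e he0, he, ?_, ?_⟩
  · ext
    rw [Units.val_mul, Units.val_zpow_eq_zpow_val, Units.val_mk0, Units.val_mk0]
    exact hake
  · rw [hake, map_mul, map_zpow₀, normAbs_eq_inv_of_isUniformizingElement hϖ,
      normAbs_eq_one_iff_valuation_eq_one.2 he, mul_one]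

include hψ hΛ hv hv0 hT in
/-- **Support**: the spherical torus function vanishes off `𝒪`: `W_v(d(a, 1)) = 0` for `|a| > 1`
(`a = ϖ^{-N} u`, `N ≥ 1`). [cite: Shintani1976, Theorem (p. 181)] -/
theorem whittakerModel_diagGL2_eq_zero_of_not_mem (a : Fˣ) (ha : (a : F) ∉ primePowBall F 0) :
    whittakerModel π Λ v (diagGL2 a 1) = 0 := by
  obtain ⟨k, u, hu, hau, hnorm⟩ := exists_eq_zpow_mul_unit hϖ a
  have hk : k < 0 := by
    by_contra hk
    push Not at hk
    exact ha (by rw [mem_primePowBall_iff, hnorm, inv_residueFieldCard_zpow_le_iff]; exact hk)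
  obtain ⟨N, hN⟩ := Int.exists_eq_neg_ofNat hk.le
  have hN0 : 0 < N := by omega
  rw [hau, whittakerModel_diagGL2_mul_unit π hϖ hΛ hv hT _ hu, hN]
  exact whittakerModel_diagGL2_zpow_neg_eq_zero π hϖ hψ hΛ hv hv0 hT hN0

include hψ hΛ hv hv0 hT in
/-- **The torus recursion in multiplicative form**: for `|a| ≤ q` (`a ∈ 𝔭^{-1}`),
`(e₂/q) Φ(a) - (e₁/q^{1/2}) Φ(a ϖ) + Φ(a ϖ²) = 0`, `Φ(a) = W_v(d(a, 1))`.
[cite: Shintani1976, Theorem (p. 181)] -/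
theorem whittakerModel_diagGL2_torus_recursion (a : Fˣ) (ha : (a : F) ∈ primePowBall F (-1)) :
    esymm x 2 / ((Real.sqrt (residueFieldCard F) : ℝ) : ℂ) ^ 2 * whittakerModel π Λ v (diagGL2 a 1) +
      -(esymm x 1 / ((Real.sqrt (residueFieldCard F) : ℝ) : ℂ)) *
        whittakerModel π Λ v (diagGL2 (a * Units.mk0 ϖ hϖ.ne_zero) 1) +
      whittakerModel π Λ v (diagGL2 (a * Units.mk0 ϖ hϖ.ne_zero ^ 2) 1) = 0 := by
  set s : ℂ := ((Real.sqrt (residueFieldCard F) : ℝ) : ℂ) with hs_def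
  have hs : s ≠ 0 := sqrt_residueFieldCard_ne_zero
  obtain ⟨k, u, hu, hau, hnorm⟩ := exists_eq_zpow_mul_unit hϖ a
  have hk : -1 ≤ k := by
    rw [mem_primePowBall_iff, hnorm, inv_residueFieldCard_zpow_le_iff] at ha
    exact ha
  obtain ⟨m, rfl⟩ : ∃ m : ℕ, k = (m : ℤ) - 1 := ⟨(k + 1).toNat, by omega⟩
  -- `Φ(a ϖⁱ) = W_{m - 1 + i}`
  have hW : ∀ i : ℤ, whittakerModel π Λ v (diagGL2 (a * Units.mk0 ϖ hϖ.ne_zero ^ i) 1) =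
      whittakerModel π Λ v (diagGL2 (Units.mk0 ϖ hϖ.ne_zero ^ ((m : ℤ) - 1 + i)) 1) := by
    intro i
    rw [hau, mul_right_comm, ← zpow_add, whittakerModel_diagGL2_mul_unit π hϖ hΛ hv hT _ hu]
  have h0 := hW 0
  have h1 := hW 1
  have h2 := hW 2
  rw [zpow_zero, mul_one, add_zero] at h0
  rw [zpow_one, sub_add_cancel] at h1
  rw [show ((m : ℤ) - 1 + 2) = (m : ℤ) + 1 by ring] at h2
  rw [← zpow_natCast (Units.mk0 ϖ hϖ.ne_zero) 2, Nat.cast_ofNat, h0, h1, h2]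
  have hrec := whittakerModel_diagGL2_recursion π hϖ hψ hΛ hv hv0 hT m
  have key : s ^ 2 * (esymm x 2 / s ^ 2 *
        whittakerModel π Λ v (diagGL2 (Units.mk0 ϖ hϖ.ne_zero ^ ((m : ℤ) - 1)) 1) +
      -(esymm x 1 / s) * whittakerModel π Λ v (diagGL2 (Units.mk0 ϖ hϖ.ne_zero ^ (m : ℤ)) 1) +
      whittakerModel π Λ v (diagGL2 (Units.mk0 ϖ hϖ.ne_zero ^ ((m : ℤ) + 1)) 1)) =
      s ^ 2 * whittakerModel π Λ v (diagGL2 (Units.mk0 ϖ hϖ.ne_zero ^ ((m : ℤ) + 1)) 1) -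
        s * esymm x 1 * whittakerModel π Λ v (diagGL2 (Units.mk0 ϖ hϖ.ne_zero ^ (m : ℤ)) 1) +
        esymm x 2 * whittakerModel π Λ v (diagGL2 (Units.mk0 ϖ hϖ.ne_zero ^ ((m : ℤ) - 1)) 1) := by
    field_simp
    ring
  rw [hrec] at key
  exact (mul_eq_zero.1 key).resolve_left (pow_ne_zero 2 hs)

end Spherical

/-! ### Part 4: the torus zeta integral of a function with a three-term recursion -/

section TorusIntegral

variable {F : Type*} [Field F] [ValuativeRel F] [TopologicalSpace F] [IsNonarchimedeanLocalField F]
  [MeasurableSpace F] [BorelSpace F]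

/-- **The finite-shell computation** (Jacquet–Langlands 1970, proof of Prop. 3.5 for the spherical
vector; the mechanism of `exists_sum_mul_integral_eq_sum` with `d = 2`, `k₁ = 0`, `k = -1`, made
explicit).  Let `Φ : Fˣ → ℂ` be continuous, vanish off `𝒪`, be constant on `𝒪ˣ`, and satisfy
`c₀ Φ(a) + c₁ Φ(a ϖ) + Φ(a ϖ²) = 0` for `|a| ≤ q` (`|ϖ| = q⁻¹`).  Then for `μ'` left invariant and
finite on compacts and `re s` large,
`(c₀ Y² + c₁ Y + 1) ∫ Φ(a) κ |a|^{s-1/2} dμ'(a) = κ Φ(1) μ'(𝒪ˣ)`, `Y = (q⁻¹)^{s-1/2}`: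
substituting `a ↦ a ϖⁱ` turns the left side into `Y² ∫ G κ |·|^{s-1/2}` with
`G = c₀ Φ + c₁ Φ(· ϖ) + Φ(· ϖ²)` supported on the single shell `|a| = q²`, where `G = Φ(1)`.
[cite: JacquetLanglands1970, Prop. 3.5] -/
theorem mul_integral_torus_eq_const (μ' : Measure Fˣ) [IsFiniteMeasureOnCompacts μ']
    [μ'.IsMulLeftInvariant] {Φ : Fˣ → ℂ} (hΦ : Continuous Φ)
    (h0 : ∀ a : Fˣ, (a : F) ∉ primePowBall F 0 → Φ a = 0)
    (h1 : ∀ a : Fˣ, normAbs F (a : F) = 1 → Φ a = Φ 1)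
    {ϖ : Fˣ} (hϖ : normAbs F (ϖ : F) = (residueFieldCard F : ℝ≥0)⁻¹) {c₀ c₁ : ℂ}
    (hrec : ∀ a : Fˣ, (a : F) ∈ primePowBall F (-1) → c₀ * Φ a + c₁ * Φ (a * ϖ) + Φ (a * ϖ ^ 2) = 0)
    (κ : ℂ) :
    ∃ σ₀ : ℝ, ∀ s : ℂ, σ₀ < s.re →
      (c₀ * (((((residueFieldCard F : ℝ≥0)⁻¹ : ℝ≥0) : ℝ) : ℂ) ^ (s - 1 / 2)) ^ 2 +
          c₁ * ((((residueFieldCard F : ℝ≥0)⁻¹ : ℝ≥0) : ℝ) : ℂ) ^ (s - 1 / 2) + 1) *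
        (∫ a, Φ a * κ * (((normAbs F (a : F) : ℝ≥0) : ℝ) : ℂ) ^ (s - 1 / 2) ∂μ') =
      κ * Φ 1 * (μ'.real {x : Fˣ | valuation F (x : F) = 1} : ℂ) := by
  haveI : BorelSpace Fˣ := Units.borelSpace
  set r : ℝ≥0 := (residueFieldCard F : ℝ≥0)⁻¹ with hr
  have hr0 : (0 : ℝ) < r := by rw [hr]; exact_mod_cast inv_residueFieldCard_pos (F := F)
  -- the recursion in the `∑ cᵢ Φ(a ϖⁱ)` form, for the growth bound
  set c : ℕ → ℂ := fun i => if i = 0 then c₀ else if i = 1 then c₁ else 1 with hc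
  have hc2 : c 2 = 1 := by simp [hc]
  have hsum : ∀ a : Fˣ, ∑ i ∈ Finset.range (2 + 1), c i * Φ (a * ϖ ^ i) =
      c₀ * Φ a + c₁ * Φ (a * ϖ) + Φ (a * ϖ ^ 2) := by
    intro a
    rw [Finset.sum_range_succ, Finset.sum_range_succ, Finset.sum_range_one]
    simp [hc]
  have hrec' : ∀ a : Fˣ, (a : F) ∈ primePowBall F (-1) →
      ∑ i ∈ Finset.range (2 + 1), c i * Φ (a * ϖ ^ i) = 0 := fun a ha => by rw [hsum]; exact hrec a ha
  obtain ⟨C, N, hle⟩ := exists_norm_le_indicator_rpow_of_recursion hΦ h0 hϖ hc2 hrec'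
  refine ⟨(N : ℝ) + 1 / 2, fun s hs => ?_⟩
  set Y : ℂ := (((r : ℝ≥0) : ℝ) : ℂ) ^ (s - 1 / 2) with hY
  have hY0 : Y ≠ 0 := by
    rw [hY, Ne, Complex.cpow_eq_zero_iff, not_and_or]
    exact Or.inl (Complex.ofReal_ne_zero.2 hr0.ne')
  set f : Fˣ → ℂ := fun a => Φ a * κ * (((normAbs F (a : F) : ℝ≥0) : ℝ) : ℂ) ^ (s - 1 / 2) with hf
  have hfi : Integrable f μ' := integrable_mul_cpow_of_norm_le μ' hΦ hle κ hs
  -- substitution `a ↦ a ϖⁱ`: `∫ f = Y^i ∫ Φ(a ϖⁱ) κ |a|^{s-1/2}`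
  have hsub : ∀ i : ℕ, (∫ a, f a ∂μ') =
      (∫ a, Φ (a * ϖ ^ i) * κ * (((normAbs F (a : F) : ℝ≥0) : ℝ) : ℂ) ^ (s - 1 / 2) ∂μ') * Y ^ i := by
    intro i
    rw [← integral_mul_right_eq_self f (ϖ ^ i), ← integral_mul_const]
    refine integral_congr_ae (Eventually.of_forall fun a => ?_)
    simp only [hf]
    rw [normAbs_mul_pow_cpow hϖ a i]
    ring
  have hfi' : ∀ i : ℕ, Integrable
      (fun a : Fˣ => Φ (a * ϖ ^ i) * κ * (((normAbs F (a : F) : ℝ≥0) : ℝ) : ℂ) ^ (s - 1 / 2)) μ' := by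
    intro i
    have h := (hfi.comp_mul_right (ϖ ^ i)).mul_const ((Y ^ i)⁻¹)
    refine h.congr (Eventually.of_forall fun a => ?_)
    simp only [hf]
    rw [normAbs_mul_pow_cpow hϖ a i, mul_assoc, mul_assoc, mul_assoc, mul_inv_cancel₀ (pow_ne_zero _ hY0),
      mul_one, mul_assoc]
  -- the function `G` and its support: the single shell `|a| = q²`
  set G : Fˣ → ℂ := fun a => c₀ * Φ a + c₁ * Φ (a * ϖ) + Φ (a * ϖ ^ 2) with hG
  have hGc : Continuous G :=
    ((continuous_const.mul hΦ).add (continuous_const.mul (hΦ.comp (continuous_mul_const _)))).add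
      (hΦ.comp (continuous_mul_const _))
  have hΦ0 : ∀ (a : Fˣ) (i : ℕ) {m : ℤ}, normAbs F (a : F) = r ^ m → m + i < 0 → Φ (a * ϖ ^ i) = 0 := by
    intro a i m hm hmi
    refine h0 _ fun hmem => ?_
    rw [mem_primePowBall_iff, normAbs_mul_pow_eq hϖ a i hm, inv_residueFieldCard_zpow_le_iff] at hmem
    omega
  have hsupp : ∀ a : Fˣ, G a ≠ 0 → ∃ j : ℕ, j < 1 ∧ normAbs F (a : F) = r ^ ((-2 : ℤ) + j) := by
    intro a hGa
    obtain ⟨m, hm⟩ := exists_normAbs_eq_inv_zpow (F := F) a.ne_zero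
    have hk' : m < -1 := by
      by_contra hmk
      push Not at hmk
      exact hGa (hrec a (by rw [mem_primePowBall_iff, hm, inv_residueFieldCard_zpow_le_iff]; exact hmk))
    have hm2 : -2 ≤ m := by
      by_contra hlt
      push Not at hlt
      apply hGa
      have e0 := hΦ0 a 0 hm (by omega)
      have e1 := hΦ0 a 1 hm (by omega)
      have e2 := hΦ0 a 2 hm (by omega)
      rw [pow_zero, mul_one] at e0
      rw [pow_one] at e1
      simp only [hG]
      rw [e0, e1, e2, mul_zero, mul_zero, add_zero, add_zero]
    refine ⟨0, zero_lt_one, ?_⟩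
    rw [hm]
    congr 1
    omega
  -- `G = Φ(1)` on that shell
  have hGshell : ∀ a : Fˣ, a ∈ {x : Fˣ | normAbs F (x : F) = r ^ ((-2 : ℤ) + ((0 : ℕ) : ℤ))} →
      G a = Φ 1 := by
    intro a ha
    have ha' : normAbs F (a : F) = r ^ (-2 : ℤ) := by simpa using ha
    have e0 := hΦ0 a 0 ha' (by norm_num)
    have e1 := hΦ0 a 1 ha' (by norm_num)
    rw [pow_zero, mul_one] at e0
    rw [pow_one] at e1
    have e2 : Φ (a * ϖ ^ 2) = Φ 1 := h1 _ (by
      rw [normAbs_mul_pow_eq hϖ a 2 ha']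
      norm_num)
    simp only [hG]
    rw [e0, e1, e2, mul_zero, mul_zero, zero_add, zero_add]
  have hshell := integral_mul_cpow_eq_sum_of_shell_support μ' hGc (-2) 1 hsupp κ (s - 1 / 2)
  rw [← hr] at hshell
  rw [Finset.sum_range_one, setIntegral_congr_fun (measurableSet_normAbs_shell _) hGshell,
    setIntegral_const] at hshell
  have hms : μ'.real {x : Fˣ | normAbs F (x : F) = r ^ ((-2 : ℤ) + ((0 : ℕ) : ℤ))} =
      μ'.real {x : Fˣ | valuation F (x : F) = 1} := by
    rw [measureReal_def, measureReal_def, hr, measure_shell μ']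
  rw [hms] at hshell
  -- the three substituted integrands
  set f₀ : Fˣ → ℂ := fun a => Φ a * κ * (((normAbs F (a : F) : ℝ≥0) : ℝ) : ℂ) ^ (s - 1 / 2) with hf₀
  set f₁ : Fˣ → ℂ := fun a => Φ (a * ϖ) * κ * (((normAbs F (a : F) : ℝ≥0) : ℝ) : ℂ) ^ (s - 1 / 2) with hf₁
  set f₂ : Fˣ → ℂ := fun a => Φ (a * ϖ ^ 2) * κ * (((normAbs F (a : F) : ℝ≥0) : ℝ) : ℂ) ^ (s - 1 / 2)
    with hf₂
  have hF0 : Integrable f₀ μ' := hfi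
  have hF1 : Integrable f₁ μ' := by have h := hfi' 1; simpa only [pow_one] using h
  have hF2 : Integrable f₂ μ' := hfi' 2
  have hI1 : (∫ a, f a ∂μ') = (∫ a, f₁ a ∂μ') * Y := by
    have h := hsub 1; simpa only [pow_one] using h
  have hI2 : (∫ a, f a ∂μ') = (∫ a, f₂ a ∂μ') * Y ^ 2 := hsub 2
  -- `∫ G κ |·|^{s-1/2} = c₀ ∫ f₀ + c₁ ∫ f₁ + ∫ f₂`
  have hGint : (∫ a, G a * κ * (((normAbs F (a : F) : ℝ≥0) : ℝ) : ℂ) ^ (s - 1 / 2) ∂μ') =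
      c₀ * (∫ a, f₀ a ∂μ') + c₁ * (∫ a, f₁ a ∂μ') + ∫ a, f₂ a ∂μ' := by
    have e : (fun a : Fˣ => G a * κ * (((normAbs F (a : F) : ℝ≥0) : ℝ) : ℂ) ^ (s - 1 / 2)) =
        fun a => c₀ * f₀ a + c₁ * f₁ a + f₂ a := by
      funext a
      simp only [hG, hf₀, hf₁, hf₂]
      ring
    have h12 : Integrable (fun a => c₀ * f₀ a + c₁ * f₁ a) μ' := (hF0.const_mul c₀).add (hF1.const_mul c₁)
    rw [e, integral_add h12 hF2, integral_add (hF0.const_mul c₀) (hF1.const_mul c₁), integral_const_mul,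
      integral_const_mul]
  -- assemble
  calc (c₀ * Y ^ 2 + c₁ * Y + 1) * (∫ a, f a ∂μ')
      = Y ^ 2 * (c₀ * (∫ a, f₀ a ∂μ') + c₁ * (∫ a, f₁ a ∂μ') + ∫ a, f₂ a ∂μ') := by
        have e0 : c₀ * Y ^ 2 * (∫ a, f a ∂μ') = Y ^ 2 * (c₀ * ∫ a, f₀ a ∂μ') := by ring
        have e1 : c₁ * Y * (∫ a, f a ∂μ') = Y ^ 2 * (c₁ * ∫ a, f₁ a ∂μ') := by rw [hI1]; ring
        have e2 : (1 : ℂ) * (∫ a, f a ∂μ') = Y ^ 2 * ∫ a, f₂ a ∂μ' := by rw [hI2]; ring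
        rw [add_mul, add_mul, e0, e1, e2]
        ring
    _ = Y ^ 2 * ∫ a, G a * κ * (((normAbs F (a : F) : ℝ≥0) : ℝ) : ℂ) ^ (s - 1 / 2) ∂μ' := by rw [hGint]
    _ = κ * Φ 1 * (μ'.real {x : Fˣ | valuation F (x : F) = 1} : ℂ) := by
        rw [hshell]
        simp only [Nat.cast_zero, add_zero]
        rw [Measure.real, Complex.real_smul]
        have hY2 : Y ^ 2 * Y ^ (-2 : ℤ) = 1 := by
          rw [← zpow_natCast, ← zpow_add₀ hY0]
          norm_num
        linear_combination (κ * Φ 1 * ((μ' {x : Fˣ | valuation F (x : F) = 1}).toReal : ℂ)) * hY2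

end TorusIntegral

/-! ### Part 5: divisibility from an exact zeta integral -/

section Comparison

/-- **Divisibility from one exact zeta integral.**  If `Z(s) = R(q^{-s}) / P(q^{-s})` on a right
half-plane with `R` a Laurent polynomial (clause (a) of `HasRSLFactor` for one test pair) and
`D(q^{-s}) Z(s) = c ≠ 0` on a right half-plane with `D(0) ≠ 0`, then `D ∣ P`: at the points
`q^{-j}`, `j ∈ ℕ` large, `c X^e P = D A` (`R = A / X^e`), two polynomials agreeing at infinitely
many points, and `D` is prime to `X`. (The argument of JPSS 1983, Thm. 2.7 (ii) / Cogdell, Thm. 3.1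
for a single generator.) [cite: JacquetPiatetskiShapiroShalika1983, Thm. 2.7 (ii)] -/
theorem dvd_of_eval_mul_eq_const {q : ℕ} (hq : 1 < q) {P D : ℂ[X]} (hP : P ≠ 0)
    (hD0 : D.eval 0 ≠ 0) (Z : ℂ → ℂ) {R : RatFunc ℂ} (hR : IsLaurent R)
    (ha : EqOnRightHalfPlane q Z (R * rsLRat P)) {c : ℂ} (hc : c ≠ 0) {σ₀ : ℝ}
    (hZ : ∀ s : ℂ, σ₀ < s.re → D.eval ((q : ℂ) ^ (-s)) * Z s = c) : D ∣ P := by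
  classical
  obtain ⟨A, e, hAe⟩ := hR
  obtain ⟨c₁, hc₁⟩ := ha
  obtain ⟨N₀, hN₀⟩ := exists_forall_lt_re_and_eval_ne_zero hq (![c₁, σ₀] : Fin 2 → ℝ)
    (![P, R.denom, (rsLRat P).denom] : Fin 3 → ℂ[X]) (fun i => by
      fin_cases i
      · exact hP
      · exact RatFunc.denom_ne_zero _
      · exact RatFunc.denom_ne_zero _)
  set t : ℕ → ℂ := fun j => ((q : ℂ) ^ j)⁻¹ with ht
  have hq0 : (q : ℂ) ≠ 0 := Nat.cast_ne_zero.2 (by omega)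
  have ht0 : ∀ j, t j ≠ 0 := fun j => inv_ne_zero (pow_ne_zero _ hq0)
  have key : ∀ j : ℕ, N₀ ≤ j → (Polynomial.C c * X ^ e * P).eval (t j) = (D * A).eval (t j) := by
    intro j hj
    obtain ⟨hre, hroot⟩ := hN₀ j hj
    have hc₁j : c₁ < ((j : ℂ)).re := by simpa using hre 0
    have hσ₀j : σ₀ < ((j : ℂ)).re := by simpa using hre 1
    have hPt : P.eval (t j) ≠ 0 := by simpa using hroot 0
    have hRd : Polynomial.eval₂ (RingHom.id ℂ) (t j) R.denom ≠ 0 := by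
      rw [Polynomial.eval₂_id]; simpa using hroot 1
    have hLd : Polynomial.eval₂ (RingHom.id ℂ) (t j) (rsLRat P).denom ≠ 0 := by
      rw [Polynomial.eval₂_id]; simpa using hroot 2
    have hqs : (q : ℂ) ^ (-(j : ℂ)) = t j := by rw [ht, Complex.cpow_neg, Complex.cpow_natCast]
    have hZj := hZ (j : ℂ) hσ₀j
    rw [hqs, hc₁ (j : ℂ) hc₁j, evalAtQ_natCast, RatFunc.eval_mul (RingHom.id ℂ) (t j) hRd hLd] at hZj
    have hA : R.eval (RingHom.id ℂ) (t j) * (t j) ^ e = A.eval (t j) := by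
      rw [hAe]; exact ratFunc_eval_laurent_mul_pow A e (ht0 j)
    have h1 : (rsLRat P).eval (RingHom.id ℂ) (t j) * P.eval (t j) = 1 := eval_rsLRat_mul_eval hP hPt
    simp only [Polynomial.eval_mul, Polynomial.eval_C, Polynomial.eval_pow, Polynomial.eval_X]
    calc c * t j ^ e * P.eval (t j)
        = D.eval (t j) * (R.eval (RingHom.id ℂ) (t j) * (rsLRat P).eval (RingHom.id ℂ) (t j)) *
            t j ^ e * P.eval (t j) := by rw [hZj]
      _ = D.eval (t j) * (R.eval (RingHom.id ℂ) (t j) * t j ^ e) *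
            ((rsLRat P).eval (RingHom.id ℂ) (t j) * P.eval (t j)) := by ring
      _ = D.eval (t j) * A.eval (t j) := by rw [hA, h1, mul_one]
  have hinf : Set.Infinite {x : ℂ | (Polynomial.C c * X ^ e * P).eval x = (D * A).eval x} := by
    refine ((Set.Ici_infinite N₀).image (inv_natCast_pow_injective hq).injOn).mono ?_
    rintro _ ⟨j, hj, rfl⟩
    exact key j hj
  have hpoly := Polynomial.eq_of_infinite_eval_eq _ _ hinf
  -- `D ∣ (c P) X^e` and `D` is prime to `X`
  have hcop : IsCoprime D (X : ℂ[X]) := by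
    refine ⟨Polynomial.C (D.coeff 0)⁻¹, -(Polynomial.C (D.coeff 0)⁻¹ * D.divX), ?_⟩
    have h0 : D.coeff 0 ≠ 0 := by rwa [Polynomial.coeff_zero_eq_eval_zero]
    have hD := Polynomial.X_mul_divX_add D
    calc Polynomial.C (D.coeff 0)⁻¹ * D + -(Polynomial.C (D.coeff 0)⁻¹ * D.divX) * X
        = Polynomial.C (D.coeff 0)⁻¹ * (D - X * D.divX) := by ring
      _ = Polynomial.C (D.coeff 0)⁻¹ * Polynomial.C (D.coeff 0) := by
          congr 1
          rw [sub_eq_iff_eq_add, add_comm, hD]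
      _ = 1 := by rw [← Polynomial.C_mul, inv_mul_cancel₀ h0, Polynomial.C_1]
  have hdvd : D ∣ (Polynomial.C c * P) * (X : ℂ[X]) ^ e := ⟨A, by rw [← hpoly]; ring⟩
  have h2 : D ∣ Polynomial.C c * P := (IsCoprime.pow_right (n := e) hcop).dvd_of_dvd_mul_right hdvd
  exact ((Polynomial.isUnit_C.2 (isUnit_iff_ne_zero.2 hc)).dvd_mul_left).1 h2

end Comparison

/-! ### Part 6: the unramified `L`-factor divides `P` -/

section Main

variable {F : Type*} [Field F] [ValuativeRel F] [TopologicalSpace F] [IsNonarchimedeanLocalField F]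


/-- `(q⁻¹)^{s - 1/2} = q^{1/2} · q^{-s}` (positive real base). [folklore] -/
theorem inv_residueFieldCard_cpow_sub_half (s : ℂ) :
    ((((residueFieldCard F : ℝ≥0)⁻¹ : ℝ≥0) : ℝ) : ℂ) ^ (s - 1 / 2) =
      ((Real.sqrt (residueFieldCard F) : ℝ) : ℂ) * ((residueFieldCard F : ℕ) : ℂ) ^ (-s) := by
  have hr0 : (0 : ℝ) < (((residueFieldCard F : ℝ≥0)⁻¹ : ℝ≥0) : ℝ) := by
    exact_mod_cast inv_residueFieldCard_pos (F := F)
  have hq0 : (0 : ℝ) ≤ (residueFieldCard F : ℝ) := Nat.cast_nonneg _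
  have hxq : ((((residueFieldCard F : ℝ≥0)⁻¹ : ℝ≥0) : ℝ) : ℂ) = ((residueFieldCard F : ℂ))⁻¹ := by
    rw [NNReal.coe_inv, NNReal.coe_natCast, Complex.ofReal_inv, Complex.ofReal_natCast]
  have hxne : ((((residueFieldCard F : ℝ≥0)⁻¹ : ℝ≥0) : ℝ) : ℂ) ≠ 0 := Complex.ofReal_ne_zero.2 hr0.ne'
  have harg : ((residueFieldCard F : ℕ) : ℂ).arg ≠ Real.pi := by
    rw [Complex.natCast_arg]; exact Real.pi_ne_zero.symm
  rw [show s - 1 / 2 = -(1 / 2 : ℂ) + s by ring, Complex.cpow_add _ _ hxne, hxq,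
    Complex.inv_cpow _ _ harg, Complex.inv_cpow _ _ harg, Complex.cpow_neg, Complex.cpow_neg, inv_inv]
  congr 1
  rw [Real.sqrt_eq_rpow, Complex.ofReal_cpow hq0, Complex.ofReal_natCast]
  congr 1
  push_cast
  ring

variable [MeasurableSpace F] [BorelSpace F]
  {V : Type*} [AddCommGroup V] [Module ℂ V] (π : Representation ℂ (GL (Fin 2) F) V)

/-- **The unramified `L`-factor divides every JPSS `L`-polynomial of `(π, 1)`** — for EVERY
`GL₁(F)`-invariant Radon full-support measure `ν` on `GL₁(F) ⧸ U₁`.  Let `π` be an irreducible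
smooth `ψ`-generic representation of `GL₂(F)` (`ψ` continuous non-trivial) and `α` a Satake
parameter of `π` (`IsSatakeParameter π ϖ α`, `ϖ` uniformising).  Then every `P` with
`HasRSLFactor (1<2) π 𝟙_{GL₁} ψ ν P` is divisible by `P_α = ∏_{a ∈ α} (1 - a X)`: the zeta integral
of the (translated) spherical vector against the constant Whittaker function of `𝟙` is EXACTLY
`Λ(v₀) μ'(𝒪ˣ) / P_α(q^{-s})` with `Λ(v₀) ≠ 0` (Parts 3–4 and Casselman–Shalika), while clause (a)
makes it `R(q^{-s}) / P(q^{-s})` with `R` Laurent (Part 5).  (Jacquet–Langlands 1970, Prop. 3.5;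
JPSS 1983, Thm. 2.7 (ii); Jacquet–Shalika 1981, §2.) [cite: JacquetLanglands1970, Prop. 3.5]
[cite: JacquetPiatetskiShapiroShalika1983, Thm. 2.7 (ii)] -/
theorem prod_one_sub_C_mul_X_dvd_of_hasRSLFactor
    [MeasurableSpace (GL (Fin 1) F ⧸ upperUnitriangular (Fin 1) F)]
    [BorelSpace (GL (Fin 1) F ⧸ upperUnitriangular (Fin 1) F)]
    [π.IsIrreducible] (hπ : π.IsSmooth) {ψ : AddChar F Circle} (hψ : ψ.IsContinuousNontrivial)
    (hgen : IsGeneric π ψ) {ϖ : Fˣ} (hϖ : IsUniformizingElement (ϖ : F)) {α : Multiset ℂ}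
    (hα : IsSatakeParameter π ϖ α)
    (ν : Measure (GL (Fin 1) F ⧸ upperUnitriangular (Fin 1) F))
    [SMulInvariantMeasure (GL (Fin 1) F) (GL (Fin 1) F ⧸ upperUnitriangular (Fin 1) F) ν]
    [IsFiniteMeasureOnCompacts ν] [ν.IsOpenPosMeasure] {P : ℂ[X]}
    (hP : HasRSLFactor Nat.one_lt_two π (Representation.trivial ℂ (GL (Fin 1) F) ℂ) ψ ν P) :
    (α.map fun a => (1 : ℂ[X]) - C a * X).prod ∣ P := by
  classical
  haveI : T2Space F :=
    (Literature.NumberTheory.GaloisRepresentations.IsNonarchimedeanLocalField.isLocalField F).toT2Space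
  haveI : BorelSpace Fˣ := Units.borelSpace
  -- the measures: `ν₀` transported from a Haar measure `μ'` of `Fˣ`; `HasRSLFactor` is `ν`-independent
  obtain ⟨μ', hμ', ν₀, hinv, hfin, hpos, hint⟩ := exists_haar_measure_quotient_fin_one (F := F)
  haveI := hμ'
  haveI := hinv
  haveI := hfin
  haveI := hpos
  have hP₀ : HasRSLFactor Nat.one_lt_two π (Representation.trivial ℂ (GL (Fin 1) F) ℂ) ψ ν₀ P :=
    (hasRSLFactor_iff_of_smulInvariant Nat.one_lt_two π _ ψ ν ν₀ P).1 hP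
  set q : ℕ := residueFieldCard F with hq_def
  have hq : 1 < q := one_lt_residueFieldCard F
  set ς : ℂ := ((Real.sqrt (residueFieldCard F) : ℝ) : ℂ) with hς_def
  have hς : ς ≠ 0 := sqrt_residueFieldCard_ne_zero
  -- a character of conductor `𝒪` and the shifted Whittaker functional
  obtain ⟨a₀, ha₀, hψa⟩ := hψ.exists_mulShift_hasConductorExp_zero
  set a : Fˣ := Units.mk0 a₀ ha₀ with ha_def
  have hψa' : (ψ.mulShift (a : F)).HasConductorExp 0 := hψa
  obtain ⟨Λ, hΛ, hΛ0⟩ := (isGeneric_iff π ψ).1 hgen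
  have hΛa := comp_mem_whittakerFunctionals_mulShift π hΛ a
  have hΛa0 := comp_ne_zero_of_ne_zero π hΛ0 (diagGL2 a 1)
  -- the spherical Hecke eigenvector, non-vanishing of `Λ_a` on it
  obtain ⟨v, hv, hv0, hΛav, hTv⟩ :=
    exists_spherical_whittaker_ne_zero_of_isSatakeParameter π hϖ hψa' hα hΛa hΛa0
  obtain ⟨x, hx⟩ := exists_univ_val_map_eq (R := ℂ) hα.1
  have hmk : Units.mk0 (ϖ : F) hϖ.ne_zero = ϖ := Units.mk0_val _ _
  have hT : ∀ r, 1 ≤ r → r ≤ 2 → heckeT π (Units.mk0 (ϖ : F) hϖ.ne_zero) r v =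
      ((((Real.sqrt (residueFieldCard F)) ^ (r * (2 - r)) : ℝ) : ℂ) * esymm x r) • v := by
    intro r _ hr2
    rw [hmk, hTv r hr2, ← hx, ← esymm_eq_multiset_esymm]
  -- the polynomial `P_α = 1 - e₁ X + e₂ X²`
  have hPα : (α.map fun a => (1 : ℂ[X]) - C a * X).prod = 1 - C (esymm x 1) * X + C (esymm x 2) * X ^ 2 := by
    rw [← hx, prod_one_sub_C_mul_X_fin_two]
  rw [hPα]
  -- the torus function `Φ` of `v` for `Λ_a`
  set Λa : Module.Dual ℂ V := Λ ∘ₗ (π (diagGL2 a 1) : V →ₗ[ℂ] V) with hΛa_def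
  set Φ : Fˣ → ℂ := fun h => whittakerModel π Λa v (diagGL2 h 1) with hΦ_def
  have hΦc : Continuous Φ := (isLocallyConstant_whittakerModel_diagGL2 π Λa (hπ v)).continuous
  have hϖn : normAbs F ((Units.mk0 (ϖ : F) hϖ.ne_zero : Fˣ) : F) = (residueFieldCard F : ℝ≥0)⁻¹ :=
    normAbs_eq_inv_of_isUniformizingElement hϖ
  have h0 : ∀ h : Fˣ, (h : F) ∉ primePowBall F 0 → Φ h = 0 := fun h hh =>
    whittakerModel_diagGL2_eq_zero_of_not_mem π hϖ hψa' hΛa hv hv0 hT h hh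
  have h1 : ∀ h : Fˣ, normAbs F (h : F) = 1 → Φ h = Φ 1 := fun h hh => by
    simp only [hΦ_def]
    rw [whittakerModel_diagGL2_eq_of_normAbs_eq_one π hϖ hΛa hv hT h hh]
  have hrec : ∀ h : Fˣ, (h : F) ∈ primePowBall F (-1) →
      esymm x 2 / ς ^ 2 * Φ h + -(esymm x 1 / ς) * Φ (h * Units.mk0 (ϖ : F) hϖ.ne_zero) +
        Φ (h * Units.mk0 (ϖ : F) hϖ.ne_zero ^ 2) = 0 := fun h hh =>
    whittakerModel_diagGL2_torus_recursion π hϖ hψa' hΛa hv hv0 hT h hh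
  have hΦ1 : Φ 1 = Λa v := by
    simp only [hΦ_def]
    rw [whittakerModel_apply, show (diagGL2 (1 : Fˣ) 1 : GL (Fin 2) F) = 1 from by
      rw [← diagGL2_one], map_one, Module.End.one_apply]
  -- the test pair: `v₁ = π(d(a,1)) v` for `Λ`, and `(id, 1)` for the trivial representation
  set Λ' : Module.Dual ℂ ℂ := LinearMap.id with hΛ'_def
  have hΛ' : Λ' ∈ whittakerFunctionals (Representation.trivial ℂ (GL (Fin 1) F) ℂ) ψ⁻¹ := by
    rw [whittakerFunctionals_eq_top_of_fin_one]; exact Submodule.mem_top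
  have hW' : ∀ g, whittakerModel (Representation.trivial ℂ (GL (Fin 1) F) ℂ) Λ' (1 : ℂ) g = 1 := fun g => by
    rw [whittakerModel_trivial_apply]; rfl
  obtain ⟨R, hR, hRe⟩ := hP₀.2.1 Λ hΛ Λ' hΛ' (π (diagGL2 a 1) v) 1
  -- the zeta integral is the torus integral of `Φ`
  have hZ : ∀ s : ℂ, rsZeta Nat.one_lt_two ν₀ (whittakerModel π Λ (π (diagGL2 a 1) v))
      (whittakerModel (Representation.trivial ℂ (GL (Fin 1) F) ℂ) Λ' 1) s =
      ∫ h, Φ h * 1 * (((normAbs F (h : F) : ℝ≥0) : ℝ) : ℂ) ^ (s - 1 / 2) ∂μ' := by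
    intro s
    rw [rsZeta_eq_integral_torus μ' ν₀ hint _ hW' s]
    refine integral_congr_ae (Eventually.of_forall fun h => ?_)
    simp only [hΦ_def, hΛa_def]
    rw [whittakerModel_apply_diagGL2_diagGL2_eq_comp]
  -- Part 4: `P_α(q^{-s}) Z(s) = Λ_a(v) μ'(𝒪ˣ)`
  obtain ⟨σ₀, hσ₀⟩ := mul_integral_torus_eq_const μ' hΦc h0 h1 hϖn hrec 1
  have hconst : (1 : ℂ) * Φ 1 * (μ'.real {x : Fˣ | valuation F (x : F) = 1} : ℂ) ≠ 0 := by
    rw [one_mul, hΦ1]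
    refine mul_ne_zero hΛav ?_
    have hpos' := measure_unitSphere_pos (F := F) μ'
    have hlt := measure_unitSphere_lt_top (F := F) μ'
    exact_mod_cast (ENNReal.toReal_pos hpos'.ne' hlt.ne).ne'
  refine dvd_of_eval_mul_eq_const hq hP₀.ne_zero ?_ _ hR hRe hconst (σ₀ := σ₀) fun s hs => ?_
  · rw [Polynomial.eval_add, Polynomial.eval_sub]
    simp
  · rw [hZ s, ← hσ₀ s hs, inv_residueFieldCard_cpow_sub_half, ← hς_def, ← hq_def]
    congr 1
    simp only [Polynomial.eval_add, Polynomial.eval_sub, Polynomial.eval_one, Polynomial.eval_mul,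
      Polynomial.eval_C, Polynomial.eval_X, Polynomial.eval_pow]
    field_simp
    ring

/-- **Equality for `deg P ≤ 2`.**  Under the hypotheses of `prod_one_sub_C_mul_X_dvd_of_hasRSLFactor`,
if moreover `deg P ≤ 2` then `P = ∏_{a ∈ α} (1 - a X)`: both Satake parameters are non-zero
(`e₂(α) ≠ 0`, the eigenvalue of the invertible `π(ϖ · 1)`), so `deg P_α = 2`, and `P(0) = 1 = P_α(0)`.
(Jacquet–Langlands 1970, Prop. 3.5: `L(s, π) = ∏ (1 - αᵢ q^{-s})⁻¹` for unramified `π`.)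
[cite: JacquetLanglands1970, Prop. 3.5] -/
theorem prod_one_sub_C_mul_X_eq_of_hasRSLFactor_of_natDegree_le_two
    [MeasurableSpace (GL (Fin 1) F ⧸ upperUnitriangular (Fin 1) F)]
    [BorelSpace (GL (Fin 1) F ⧸ upperUnitriangular (Fin 1) F)]
    [π.IsIrreducible] (hπ : π.IsSmooth) {ψ : AddChar F Circle} (hψ : ψ.IsContinuousNontrivial)
    (hgen : IsGeneric π ψ) {ϖ : Fˣ} (hϖ : IsUniformizingElement (ϖ : F)) {α : Multiset ℂ}
    (hα : IsSatakeParameter π ϖ α)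
    (ν : Measure (GL (Fin 1) F ⧸ upperUnitriangular (Fin 1) F))
    [SMulInvariantMeasure (GL (Fin 1) F) (GL (Fin 1) F ⧸ upperUnitriangular (Fin 1) F) ν]
    [IsFiniteMeasureOnCompacts ν] [ν.IsOpenPosMeasure] {P : ℂ[X]}
    (hP : HasRSLFactor Nat.one_lt_two π (Representation.trivial ℂ (GL (Fin 1) F) ℂ) ψ ν P)
    (hdeg : P.natDegree ≤ 2) :
    P = (α.map fun a => (1 : ℂ[X]) - C a * X).prod := by
  classical
  have hdvd := prod_one_sub_C_mul_X_dvd_of_hasRSLFactor π hπ hψ hgen hϖ hα ν hP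
  -- `e₂ ≠ 0`, so `deg P_α = 2`
  obtain ⟨hcard, v, hv, hv0, hTv⟩ := hα
  obtain ⟨x, hx⟩ := exists_univ_val_map_eq (R := ℂ) hcard
  have hmk : Units.mk0 (ϖ : F) hϖ.ne_zero = ϖ := Units.mk0_val _ _
  have hT : ∀ r, 1 ≤ r → r ≤ 2 → heckeT π (Units.mk0 (ϖ : F) hϖ.ne_zero) r v =
      ((((Real.sqrt (residueFieldCard F)) ^ (r * (2 - r)) : ℝ) : ℂ) * esymm x r) • v := by
    intro r _ hr2
    rw [hmk, hTv r hr2, ← hx, ← esymm_eq_multiset_esymm]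
  have he2 : esymm x 2 ≠ 0 := esymm_two_ne_zero_of_eigen π hϖ hv hv0 hT
  have hPα : (α.map fun a => (1 : ℂ[X]) - C a * X).prod = 1 - C (esymm x 1) * X + C (esymm x 2) * X ^ 2 := by
    rw [← hx, prod_one_sub_C_mul_X_fin_two]
  rw [hPα] at hdvd ⊢
  set D : ℂ[X] := 1 - C (esymm x 1) * X + C (esymm x 2) * X ^ 2 with hD
  have hDdeg : D.natDegree = 2 := by
    rw [hD]
    have : (1 - C (esymm x 1) * X + C (esymm x 2) * X ^ 2 : ℂ[X]) =
        C (esymm x 2) * X ^ 2 + C (-(esymm x 1)) * X + C 1 := by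
      simp only [map_neg, map_one]; ring
    rw [this]
    exact Polynomial.natDegree_quadratic he2
  have hD0 : D.eval 0 = 1 := by simp [hD]
  have hPne : P ≠ 0 := hP.ne_zero
  obtain ⟨E, hE⟩ := hdvd
  have hEne : E ≠ 0 := by rintro rfl; exact hPne (by rw [hE, mul_zero])
  have hDne : D ≠ 0 := fun h => by rw [h, Polynomial.natDegree_zero] at hDdeg; exact absurd hDdeg (by decide)
  have hdegE : E.natDegree = 0 := by
    have h := Polynomial.natDegree_mul hDne hEne
    rw [← hE, hDdeg] at h
    omega
  obtain ⟨e, rfl⟩ := Polynomial.natDegree_eq_zero.1 hdegE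
  -- compare constant terms: `P(0) = 1 = D(0) e`
  have he : e = 1 := by
    have h := hP.1
    rw [hE, Polynomial.eval_mul, hD0, one_mul, Polynomial.eval_C] at h
    exact h
  rw [hE, he, map_one, mul_one]

end Main

end Literature.NumberTheory.Automorphic

end
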